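import Summits.FinalStateConjecture.FinalStateConjecture.Theses.ClusterCompleteness
import Summits.FinalStateConjecture.FinalStateConjecture.Theorems.ClusterCompletenessOmegaLimitMultiKerrBirthDefs
import Literature.Geometry.Lorentzian.HorizonLineage
import Literature.Geometry.Lorentzian.CausalityOpennessProofs
import Literature.Geometry.Lorentzian.CausalityChronologyProofs
import Literature.Geometry.Lorentzian.CausalityPushUp
import Literature.Geometry.Lorentzian.IdealPoints
import Literature.Geometry.Lorentzian.ApproximateKerrConfiguration
import Summits.FinalStateConjecture.FinalStateConjecture.Theorems.ClusterCompletenessLinearToNonlinearCaptureStubIsOpenSubsetChronologicalPast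
import HarnessLib

/-!
# Stub S_R′ `stub_raysStayInClosure_transfer_cofinal` of line `thrift-handoff` (skeleton v2) of the
# crux `LinearToNonlinearCapture` (stmt-FinalStateConjecture-14526): cofinal transfer of the ray clause

The v1 stub S_R asserted `RaysStayInClosure 𝒟 O′` for EVERY honest decomposition `d′` of a maximal
development recurring at order `k`; nothing in its hypotheses related the late charted events of the
recurrent exterior `O` to `d′.charted`, so that form was not derivable (lead c14, wave 1). The
registered v2 stub is the COFINAL TRANSFER proved here (P4′), with its causal plumbing (O'Neill 1983,
Ch. 14, pp. 402–403: `≪` is transitive, `I⁺(q)` is open on a manifold without boundary):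
* P1 `raysStayInClosure_of_closure_subset` — monotone under `closure O ⊆ closure O′`;
* P2 `exteriorOf_subset_exteriorOf_of_subset_closure` — `U ⊆ closure (exteriorOf U′)` gives
  `exteriorOf U ⊆ exteriorOf U′` (`q ≪ p ∈ U`, the open `I⁺(q)` meets `exteriorOf U′ ⊆ I⁻(U′)`);
* P3 `raysStayInClosure_exteriorOf_of_subset_closure`, P4 `raysStayInClosure_transfer_of_subset_closure`,
  P4′ `stub_raysStayInClosure_transfer_cofinal` (the registered text: any order / order 2);
* P5, P6 `subset_closure_exteriorOf_of_exhaustion`, `exteriorOf_eq_exteriorOf_of_exhaustion` — inside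
  ONE charted exterior, exhaustion makes the exterior of the charted set equal to the exterior of any
  later open charted piece (`J⁻ ⊆ closure I⁻`, O'Neill 1983, Lemma 14.6);
* P7 `timeSlab_subset_closure_lateRegion` (+ flat / boosted-Kerr instances);
* P8, P9 `exteriorOf_recurrentCharts_eq_late`, `raysStayInClosure_recurrentCharts_late` — for the
  chart data of `RecursO k 𝒟` (clauses C2, C3, C8, C10 as hypotheses) and every `τ₁ > τ₀`, `O` is the
  exterior of the late chart images after `τ₁`, so clause C9 transfers to them: the intended witness
  `U` of the restart stub's cofinality certificate `∃ U, RaysStayInClosure (exteriorOf U) ∧ U ⊆ closure O′`.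
-/

noncomputable section

open scoped BigOperators Topology Manifold ENNReal ContDiff
open Filter Set Function TopologicalSpace
open Literature.Geometry.Lorentzian
open Summit.FinalStateConjecture.FinalStateConjecture.Theorems.ClusterCompleteness

namespace Summit.FinalStateConjecture.FinalStateConjecture.Theorems

set_option linter.dupNamespace false

variable {X : Type} [TopologicalSpace X] [ChartedSpace E3 X] [IsManifold (𝓡 3) ∞ X]
  [ConnectedSpace X] {D : InitialDataSet (𝓡 3) X}

/-- **(P1) `RaysStayInClosure` is monotone under inclusion of closures.** If every
future-complete normalised null ray from the data stays in `closure O`, and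
`closure O ⊆ closure O′`, then every such ray stays in `closure O′`. Pure logic on the definition
`Summit.FinalStateConjecture.RaysStayInClosure` (Dafermos–Luk arXiv:1710.01722, Conjecture 1, for
the region; Christodoulou, CQG 16 (1999), pp. A26–A27, for the rays). -/
theorem raysStayInClosure_of_closure_subset {𝒟 : CauchyDevelopment D} {O O' : Set 𝒟.carrier}
    (h : Summit.FinalStateConjecture.RaysStayInClosure 𝒟 O) (hOO' : closure O ⊆ closure O') :
    Summit.FinalStateConjecture.RaysStayInClosure 𝒟 O' := by
  intro _ p γ dom hγ hdom t ht ht0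
  exact hOO' (h p γ dom hγ hdom t ht ht0)

/-- **(P2) The exterior region is monotone up to closure in the charted set.** For a Cauchy
development `𝒟` and sets `U, U′` of events with `U ⊆ closure (exteriorOf 𝒟 U′)`:
`exteriorOf 𝒟 U ⊆ exteriorOf 𝒟 U′`, where `exteriorOf 𝒟 V = J⁺(ι Σ) ∩ I⁻(V)`. Proof: for
`q ∈ J⁺(ι Σ) ∩ I⁻(U)` pick `p ∈ U` with `q ≪ p`; the chronological future `I⁺(q)` is open (the
carrier of a spacetime has no boundary; O'Neill 1983, Ch. 14, Lemma 14.3, p. 403) and contains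
`p ∈ closure (exteriorOf 𝒟 U′)`, so it meets `exteriorOf 𝒟 U′ ⊆ I⁻(U′)` in some `p′`; then
`q ≪ p′ ≪ u′` with `u′ ∈ U′`, and `≪` is transitive (O'Neill 1983, Ch. 14, p. 402), so
`q ∈ I⁻(U′)`. -/
theorem exteriorOf_subset_exteriorOf_of_subset_closure (𝒟 : CauchyDevelopment D)
    {U U' : Set 𝒟.carrier}
    (hU : U ⊆ closure (Summit.FinalStateConjecture.exteriorOf 𝒟 U')) :
    Summit.FinalStateConjecture.exteriorOf 𝒟 U ⊆ Summit.FinalStateConjecture.exteriorOf 𝒟 U' := by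
  rintro q ⟨hqJ, hqI⟩
  refine ⟨hqJ, ?_⟩
  -- `q ≪ p` for some `p ∈ U`
  obtain ⟨p, hpU, γ, a, b, hab, hγ, hγa, hγb⟩ := hqI
  have hqp : q ∈ 𝒟.metric.chronologicalPast 𝒟.timeOrientation {p} :=
    ⟨p, rfl, γ, a, b, hab, hγ, hγa, hγb⟩
  have hpq : p ∈ 𝒟.metric.chronologicalFuture 𝒟.timeOrientation {q} :=
    LorentzianMetric.mem_chronologicalFuture_of_mem_chronologicalPast hqp
  -- `I⁺(q)` is an open neighbourhood of `p ∈ closure (exteriorOf U')`, so it meets `exteriorOf U'`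
  have hopen : IsOpen (𝒟.metric.chronologicalFuture 𝒟.timeOrientation {q}) :=
    LorentzianMetric.isOpen_chronologicalFuture_of_boundaryless 𝒟.metric 𝒟.timeOrientation {q}
  obtain ⟨p', hp'F, -, hp'I⟩ := mem_closure_iff.mp (hU hpU) _ hopen hpq
  -- `q ≪ p' ≪ u'` with `u' ∈ U'`
  exact LorentzianMetric.mem_chronologicalPast_trans hp'I
    (LorentzianMetric.mem_chronologicalPast_of_mem_chronologicalFuture hp'F)

/-- **(P2′) Equality form.** If moreover `U′ ⊆ closure (exteriorOf 𝒟 U)`, the two exterior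
regions coincide. O'Neill 1983, Ch. 14, pp. 402–403. -/
theorem exteriorOf_eq_exteriorOf_of_subset_closure (𝒟 : CauchyDevelopment D)
    {U U' : Set 𝒟.carrier}
    (hU : U ⊆ closure (Summit.FinalStateConjecture.exteriorOf 𝒟 U'))
    (hU' : U' ⊆ closure (Summit.FinalStateConjecture.exteriorOf 𝒟 U)) :
    Summit.FinalStateConjecture.exteriorOf 𝒟 U = Summit.FinalStateConjecture.exteriorOf 𝒟 U' :=
  (exteriorOf_subset_exteriorOf_of_subset_closure 𝒟 hU).antisymm
    (exteriorOf_subset_exteriorOf_of_subset_closure 𝒟 hU')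

/-- **(P3) Transfer of the ray clause between exterior regions.** If the complete rays stay in
`closure (exteriorOf 𝒟 U)` and `U ⊆ closure (exteriorOf 𝒟 U′)`, then they stay in
`closure (exteriorOf 𝒟 U′)` (P1 with P2 and `closure_mono`). O'Neill 1983, Ch. 14, pp. 402–403;
Dafermos–Luk arXiv:1710.01722, Conjecture 1. -/
theorem raysStayInClosure_exteriorOf_of_subset_closure (𝒟 : CauchyDevelopment D)
    {U U' : Set 𝒟.carrier}
    (h : Summit.FinalStateConjecture.RaysStayInClosure 𝒟 (Summit.FinalStateConjecture.exteriorOf 𝒟 U))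
    (hU : U ⊆ closure (Summit.FinalStateConjecture.exteriorOf 𝒟 U')) :
    Summit.FinalStateConjecture.RaysStayInClosure 𝒟 (Summit.FinalStateConjecture.exteriorOf 𝒟 U') :=
  raysStayInClosure_of_closure_subset h
    (closure_mono (exteriorOf_subset_exteriorOf_of_subset_closure 𝒟 hU))

/-- **(P4) The reshaped stub S_R′ (`RecursO`-free).** For a vacuum Cauchy development `𝒟`, a
set of events `U` whose exterior `exteriorOf 𝒟 U` captures the complete rays (for the recurrent
charts of `RecursO k 𝒟` this is its clause C9 with C8), and a decomposition `d′` of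
`O′ = exteriorOf 𝒟 d′.charted`: if `U ⊆ closure O′` (COFINALITY: every event of `U` is a limit
of events of `J⁺(ι Σ)` chronologically below `d′.charted`), then `RaysStayInClosure 𝒟 O′`.
O'Neill 1983, Ch. 14, pp. 402–403; Dafermos–Luk arXiv:1710.01722, Conjecture 1. -/
theorem raysStayInClosure_transfer_of_subset_closure :
    ∀ (X : Type) [TopologicalSpace X] [ChartedSpace E3 X] [IsManifold (𝓡 3) ∞ X] [T2Space X]
    [SecondCountableTopology X] [ConnectedSpace X] (D : InitialDataSet (𝓡 3) X)
    (𝒟 : VacuumCauchyDevelopment D) (U O' : Set 𝒟.carrier) {k : ℕ}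
    (d' : FinalStateDecomposition 𝒟.toSpacetime O' k),
    O' = Summit.FinalStateConjecture.exteriorOf 𝒟.toCauchyDevelopment d'.charted →
    Summit.FinalStateConjecture.RaysStayInClosure 𝒟.toCauchyDevelopment
      (Summit.FinalStateConjecture.exteriorOf 𝒟.toCauchyDevelopment U) →
    U ⊆ closure O' →
    Summit.FinalStateConjecture.RaysStayInClosure 𝒟.toCauchyDevelopment O' := by
  intro X _ _ _ _ _ _ D 𝒟 U O' k d' hO' h hU
  rw [hO'] at hU ⊢
  exact raysStayInClosure_exteriorOf_of_subset_closure 𝒟.toCauchyDevelopment h hU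

/-- **(P4′) The reshaped stub in the skeleton's exact quantifier prefix** (recommended
registration text for S_R′; the admissibility and maximality hypotheses are carried only to match
the neighbours and are not used): for every maximal vacuum Cauchy development of admissible data,
every set of events `U` whose exterior captures the complete rays, and every `C²` decomposition
`d′` of `O′ = exteriorOf d′.charted` which SEES `U` (`U ⊆ closure O′`), the rays stay in
`closure O′`. O'Neill 1983, Ch. 14, pp. 402–403; Dafermos–Luk arXiv:1710.01722, Conjecture 1. -/
theorem stub_raysStayInClosure_transfer_cofinal :
    ∀ (X : Type) [TopologicalSpace X] [ChartedSpace E3 X] [IsManifold (𝓡 3) ∞ X] [T2Space X]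
    [SecondCountableTopology X] [ConnectedSpace X], ∀ D ∈ admissibleVacuumData X, ∀ 𝒟 :
    VacuumCauchyDevelopment D, 𝒟.IsMaximal → ∀ (U O' : Set 𝒟.carrier) (d' :
    FinalStateDecomposition 𝒟.toSpacetime O' 2), O' = Summit.FinalStateConjecture.exteriorOf
    𝒟.toCauchyDevelopment d'.charted → Summit.FinalStateConjecture.RaysStayInClosure
    𝒟.toCauchyDevelopment (Summit.FinalStateConjecture.exteriorOf 𝒟.toCauchyDevelopment U) →
    U ⊆ closure O' → Summit.FinalStateConjecture.RaysStayInClosure 𝒟.toCauchyDevelopment O' := by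
  intro X _ _ _ _ _ _ D _ 𝒟 _ U O' d' hO' h hU
  exact raysStayInClosure_transfer_of_subset_closure X D 𝒟 U O' d' hO' h hU

/-! ### Cofinality inside one charted exterior: late chart images determine the exterior -/

/-- **`I⁻(closure V) ⊆ I⁻(V)`** on the carrier of a Cauchy development: if `q ≪ u` with
`u ∈ closure V`, the open set `I⁺(q) ∋ u` (O'Neill 1983, Ch. 14, Lemma 14.3, p. 403) meets `V` in
some `v`, and `q ≪ v`. -/
theorem chronologicalPast_closure_subset (𝒟 : CauchyDevelopment D) (V : Set 𝒟.carrier) :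
    𝒟.metric.chronologicalPast 𝒟.timeOrientation (closure V) ⊆
      𝒟.metric.chronologicalPast 𝒟.timeOrientation V := by
  rintro q ⟨u, huV, γ, a, b, hab, hγ, hγa, hγb⟩
  have hqu : q ∈ 𝒟.metric.chronologicalPast 𝒟.timeOrientation {u} :=
    ⟨u, rfl, γ, a, b, hab, hγ, hγa, hγb⟩
  have huq : u ∈ 𝒟.metric.chronologicalFuture 𝒟.timeOrientation {q} :=
    LorentzianMetric.mem_chronologicalFuture_of_mem_chronologicalPast hqu
  obtain ⟨v, hvF, hvV⟩ := mem_closure_iff.mp huV _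
    (LorentzianMetric.isOpen_chronologicalFuture_of_boundaryless 𝒟.metric 𝒟.timeOrientation {q})
    huq
  exact LorentzianMetric.chronologicalPast_mono (singleton_subset_iff.mpr hvV)
    (LorentzianMetric.mem_chronologicalPast_of_mem_chronologicalFuture hvF)

/-- **`J⁻(S) ⊆ closure I⁻(S)`** on the carrier of a Cauchy development (a `4`-manifold without
boundary, smooth metric): O'Neill 1983, Ch. 14, Lemma 14.6 (2) (p. 404), time dual
(`LorentzianMetric.causalFuture_subset_closure_chronologicalFuture_of_boundaryless` for the
reversed time orientation). -/
theorem causalPast_subset_closure_chronologicalPast (𝒟 : CauchyDevelopment D)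
    (S : Set 𝒟.carrier) :
    𝒟.metric.causalPast 𝒟.timeOrientation S ⊆
      closure (𝒟.metric.chronologicalPast 𝒟.timeOrientation S) :=
  LorentzianMetric.causalFuture_subset_closure_chronologicalFuture_of_boundaryless
    (g := 𝒟.metric) (τ := 𝒟.timeOrientation.reverse) (by exact_mod_cast le_top) S

/-- **(P5) Exhaustion puts the charted set in the closure of a later exterior.** Let `C` be an
open set of events to the causal future of the data (`C ⊆ J⁺(ι Σ)`; the charted late region),
exhausted in the sense `C ∖ U₁ ⊆ J⁻(S)` by a certified part `U₁` of a later open charted piece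
`V ⊇ U₁` and a slab `S ⊆ closure V`. Then `C ⊆ closure (exteriorOf 𝒟 V)`. Proof: a point of
`U₁ ⊆ V` lies in `I⁻(V)` (an open set lies in its own chronological past, O'Neill 1983, Ch. 14,
p. 402); a point of `J⁻(S)` lies in `closure I⁻(S) ⊆ closure I⁻(closure V) = closure I⁻(V)`
(Lemma 14.6 (2), p. 404, and Lemma 14.3, p. 403); finally `C` is an open neighbourhood inside
`J⁺(ι Σ)`, so `C ∩ closure I⁻(V) ⊆ closure (J⁺(ι Σ) ∩ I⁻(V))`. -/
theorem subset_closure_exteriorOf_of_exhaustion (𝒟 : CauchyDevelopment D)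
    {C U₁ V S : Set 𝒟.carrier} (hC : IsOpen C)
    (hCJ : C ⊆ 𝒟.metric.causalFuture 𝒟.timeOrientation (range 𝒟.embed))
    (hexh : C \ U₁ ⊆ 𝒟.metric.causalPast 𝒟.timeOrientation S)
    (hU₁V : U₁ ⊆ V) (hV : IsOpen V) (hSV : S ⊆ closure V) :
    C ⊆ closure (Summit.FinalStateConjecture.exteriorOf 𝒟 V) := by
  intro c hc
  have h1 : c ∈ closure (𝒟.metric.chronologicalPast 𝒟.timeOrientation V) := by
    by_cases hcU : c ∈ U₁
    · exact subset_closure (stub_isOpen_subset_chronologicalPast 𝒟.toSpacetime hV (hU₁V hcU))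
    · exact closure_mono ((LorentzianMetric.chronologicalPast_mono hSV).trans
        (chronologicalPast_closure_subset 𝒟 V))
        (causalPast_subset_closure_chronologicalPast 𝒟 S (hexh ⟨hc, hcU⟩))
  have h2 : c ∈ closure (C ∩ 𝒟.metric.chronologicalPast 𝒟.timeOrientation V) :=
    hC.inter_closure ⟨hc, h1⟩
  exact closure_mono (inter_subset_inter_left _ hCJ) h2

/-- **(P6) Exhaustion makes the exterior independent of the restart time.** Under the hypotheses
of `subset_closure_exteriorOf_of_exhaustion` and `V ⊆ C`: `exteriorOf 𝒟 C = exteriorOf 𝒟 V`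
(P5 with P2 for `⊆`, monotonicity for `⊇`). O'Neill 1983, Ch. 14, pp. 402–404. -/
theorem exteriorOf_eq_exteriorOf_of_exhaustion (𝒟 : CauchyDevelopment D)
    {C U₁ V S : Set 𝒟.carrier} (hC : IsOpen C)
    (hCJ : C ⊆ 𝒟.metric.causalFuture 𝒟.timeOrientation (range 𝒟.embed))
    (hexh : C \ U₁ ⊆ 𝒟.metric.causalPast 𝒟.timeOrientation S)
    (hU₁V : U₁ ⊆ V) (hV : IsOpen V) (hSV : S ⊆ closure V) (hVC : V ⊆ C) :
    Summit.FinalStateConjecture.exteriorOf 𝒟 C = Summit.FinalStateConjecture.exteriorOf 𝒟 V :=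
  (exteriorOf_subset_exteriorOf_of_subset_closure 𝒟
    (subset_closure_exteriorOf_of_exhaustion 𝒟 hC hCJ hexh hU₁V hV hSV)).antisymm
    (inter_subset_inter_right _ (LorentzianMetric.chronologicalPast_mono hVC))

/-! ### Chart slabs lie in the closure of the later late region -/

/-- **(P7) Slabs `{t = τ}` lie in the closure of `{t > τ}`** for a reference background whose
time function is translated by a fixed coordinate vector `v` (`t(x + s v) = t(x) + s`): the points
`x + s v`, `s → 0⁺`, stay in the open domain and have time `τ + s > τ`. Elementary (flat and
Kerr–Schild chart time; Dafermos–Rodnianski arXiv:0811.0354, §5.1). -/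
theorem timeSlab_subset_closure_lateRegion (B : ModelBackground) (v : E4)
    (hv : ∀ (x : E4) (s : ℝ), B.time (x + s • v) = B.time x + s) (τ : ℝ) :
    B.timeSlab τ ⊆ closure (B.lateRegion τ) := by
  intro x hx
  rw [ModelBackground.mem_timeSlab] at hx
  rw [closure_subtype]
  have hcont : Continuous fun s : ℝ ↦ x.1 + s • v :=
    continuous_const.add (continuous_id.smul continuous_const)
  have h0 : x.1 + (0 : ℝ) • v = x.1 := by rw [zero_smul, add_zero]
  have hdom : ∀ᶠ s in 𝓝 (0 : ℝ), x.1 + s • v ∈ (B.domain : Set E4) :=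
    hcont.continuousAt.preimage_mem_nhds (by rw [h0]; exact B.domain.isOpen.mem_nhds x.2)
  have htend : Tendsto (fun s : ℝ ↦ x.1 + s • v) (𝓝[>] 0) (𝓝 x.1) := by
    have h := hcont.continuousAt (x := (0 : ℝ))
    rw [ContinuousAt, h0] at h
    exact h.mono_left nhdsWithin_le_nhds
  refine mem_closure_of_tendsto htend ?_
  filter_upwards [self_mem_nhdsWithin, hdom.filter_mono nhdsWithin_le_nhds] with s hs hsdom
  refine ⟨⟨x.1 + s • v, hsdom⟩, ?_, rfl⟩
  show τ < B.time (x.1 + s • v)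
  rw [hv, hx]
  exact lt_add_of_pos_right τ hs

/-- (P7, flat) The flat slab `{x⁰ = τ} ∩ U₀` lies in the closure of `{x⁰ > τ} ∩ U₀`
(translate along `∂₀`). [folklore] -/
theorem Minkowski_timeSlab_subset_closure_lateRegion (U₀ : Opens E4) (τ : ℝ) :
    (Minkowski.backgroundOn U₀).timeSlab τ ⊆
      closure ((Minkowski.backgroundOn U₀).lateRegion τ) :=
  timeSlab_subset_closure_lateRegion (Minkowski.backgroundOn U₀) (E4.basisVector 0)
    (fun x s ↦ by
      show (x + s • E4.basisVector 0) 0 = x 0 + s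
      simp) τ

/-- (P7, boosted Kerr) The Kerr–Schild slab `{t* = τ}` of the boosted background lies in the
closure of `{t* > τ}` (translate along `Λ ∂₀`: `Λ⁻¹(x + s Λ∂₀ − c) = Λ⁻¹(x − c) + s ∂₀`).
[folklore] -/
theorem boostedKerr_timeSlab_subset_closure_lateRegion (Λ : lorentzGroup) (c : E4) (M a τ : ℝ) :
    (boostedKerrBackground Λ c M a).timeSlab τ ⊆
      closure ((boostedKerrBackground Λ c M a).lateRegion τ) :=
  timeSlab_subset_closure_lateRegion (boostedKerrBackground Λ c M a)
    ((Λ : E4 ≃L[ℝ] E4) (E4.basisVector 0)) (fun x s ↦ by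
      show poincareInv Λ c (x + s • (Λ : E4 ≃L[ℝ] E4) (E4.basisVector 0)) 0 =
        poincareInv Λ c x 0 + s
      have h : x + s • (Λ : E4 ≃L[ℝ] E4) (E4.basisVector 0) - c =
          (x - c) + s • (Λ : E4 ≃L[ℝ] E4) (E4.basisVector 0) := by abel
      simp only [poincareInv]
      rw [h, map_add, map_smul, ContinuousLinearEquiv.symm_apply_apply]
      simp) τ

/-! ### The recurrent charts: late images determine the exterior, so C9 holds at every `τ₁` -/

/-- The image of a later late region `{t > τ₁}`, `τ₁ ≥ τ₀`, under a late chart after `τ₀` (with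
continuous chart time) is open in the spacetime. [folklore] -/
theorem isOpen_image_lateRegion_of_isLateChart {𝓢 : Spacetime.{0} 4} {B : ModelBackground}
    {O : Set 𝓢.carrier} {τ₀ τ₁ : ℝ} {Ψ : B.domain → 𝓢.carrier}
    (h : 𝓢.IsLateChart B O τ₀ Ψ) (hB : Continuous B.time) (hτ : τ₀ ≤ τ₁) :
    IsOpen (Ψ '' B.lateRegion τ₁) := by
  rw [← range_restrict]
  exact (h.isOpenEmbedding.comp (Topology.IsOpenEmbedding.inclusion (B.lateRegion_mono hτ)
    ((B.isOpen_lateRegion hB τ₁).preimage continuous_subtype_val))).isOpen_range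

/-- **(P8) For the chart data of `RecursO k 𝒟`, the exterior is determined by arbitrarily late
chart images.** Let hole charts `Ψᵢ` (boosted Kerr backgrounds) and a flat chart `Ψ₀` be late
charts into `O` after `τ₀` (clauses C2, C3), `O` the exterior of their late images (C8), and let
`O` be exhausted at the chart time `τ₁ > τ₀` (clause C10 at `τ₁`). Then `O` is also the exterior
of the late images AFTER `τ₁`. (P6 with `C` = late images after `τ₀`, `V` = late images after
`τ₁`, `U₁` = the certified late region, `S` = the certified slab at `τ₁`; slabs lie in the
closure of later late regions by P7, charts are continuous.) O'Neill 1983, Ch. 14, pp. 402–404;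
Dafermos–Luk arXiv:1710.01722, §1.2.1. -/
theorem exteriorOf_recurrentCharts_eq_late
    {X : Type} [TopologicalSpace X] [ChartedSpace E3 X] [IsManifold (𝓡 3) ∞ X]
    [T2Space X] [SecondCountableTopology X] [ConnectedSpace X]
    {D : InitialDataSet (𝓡 3) X} (𝒟 : VacuumCauchyDevelopment D)
    {O : Set 𝒟.carrier} {N : ℕ} {M a : Fin N → ℝ} {mo : Fin N → lorentzGroup × E4} {τ₀ τ₁ : ℝ}
    {Ψ : ∀ i, boostedKerrExterior (mo i).1 (mo i).2 (M i) (a i) → 𝒟.carrier}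
    {R : Fin N → ℝ → ℝ} {U₀ : Opens E4} {Ψ₀ : U₀ → 𝒟.carrier}
    (hΨ : ∀ i, 𝒟.toSpacetime.IsLateChart
      (boostedKerrBackground (mo i).1 (mo i).2 (M i) (a i)) O τ₀ (Ψ i))
    (hΨ₀ : 𝒟.toSpacetime.IsLateChart (Minkowski.backgroundOn U₀) O τ₀ Ψ₀)
    (hO : O = Summit.FinalStateConjecture.exteriorOf 𝒟.toCauchyDevelopment
      ((⋃ i, Ψ i '' (boostedKerrBackground (mo i).1 (mo i).2 (M i) (a i)).lateRegion τ₀) ∪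
        Ψ₀ '' (Minkowski.backgroundOn U₀).lateRegion τ₀))
    (hτ : τ₀ < τ₁)
    (hexh : O \ (Ψ₀ '' (Minkowski.backgroundOn U₀).lateRegion τ₁ ∪
        ⋃ i, Ψ i '' {x | τ₁ < (boostedKerrBackground (mo i).1 (mo i).2 (M i) (a i)).time x.1 ∧
          (boostedKerrBackground (mo i).1 (mo i).2 (M i) (a i)).radius x.1 ≤
            R i ((boostedKerrBackground (mo i).1 (mo i).2 (M i) (a i)).time x.1)}) ⊆
      𝒟.metric.causalPast 𝒟.timeOrientation
        (Ψ₀ '' (Minkowski.backgroundOn U₀).timeSlab τ₁ ∪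
          ⋃ i, Ψ i '' (boostedKerrBackground (mo i).1 (mo i).2 (M i) (a i)).truncTimeSlab
            (R i τ₁) τ₁)) :
    O = Summit.FinalStateConjecture.exteriorOf 𝒟.toCauchyDevelopment
      ((⋃ i, Ψ i '' (boostedKerrBackground (mo i).1 (mo i).2 (M i) (a i)).lateRegion τ₁) ∪
        Ψ₀ '' (Minkowski.backgroundOn U₀).lateRegion τ₁) := by
  -- continuity of the chart times
  have hcK : ∀ i, Continuous (boostedKerrBackground (mo i).1 (mo i).2 (M i) (a i)).time :=
    fun i ↦ continuous_time_boostedKerrBackground _ _ _ _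
  have hc0 : Continuous (Minkowski.backgroundOn U₀).time := Minkowski.continuous_time_backgroundOn U₀
  -- openness of the late images after `τ₀` and after `τ₁`
  have hopen : ∀ {τ : ℝ}, τ₀ ≤ τ → IsOpen
      ((⋃ i, Ψ i '' (boostedKerrBackground (mo i).1 (mo i).2 (M i) (a i)).lateRegion τ) ∪
        Ψ₀ '' (Minkowski.backgroundOn U₀).lateRegion τ) := fun hle ↦
    (isOpen_iUnion fun i ↦ isOpen_image_lateRegion_of_isLateChart (hΨ i) (hcK i) hle).union
      (isOpen_image_lateRegion_of_isLateChart hΨ₀ hc0 hle)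
  -- the late images after `τ₀` lie in `O ⊆ J⁺(ι Σ)`
  have hCO : (⋃ i, Ψ i '' (boostedKerrBackground (mo i).1 (mo i).2 (M i) (a i)).lateRegion τ₀) ∪
      Ψ₀ '' (Minkowski.backgroundOn U₀).lateRegion τ₀ ⊆ O :=
    union_subset (iUnion_subset fun i ↦ (hΨ i).image_subset) hΨ₀.image_subset
  have hOJ : O ⊆ 𝒟.metric.causalFuture 𝒟.timeOrientation (range 𝒟.embed) := by
    rw [hO]
    exact inter_subset_left
  rw [hO] at hexh ⊢
  refine exteriorOf_eq_exteriorOf_of_exhaustion 𝒟.toCauchyDevelopment (hopen le_rfl)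
    (hCO.trans hOJ) ((sdiff_subset_sdiff_left (hO ▸ hCO)).trans hexh) ?_ (hopen hτ.le) ?_ ?_
  · -- certified late region after `τ₁` ⊆ late images after `τ₁`
    exact union_subset subset_union_right (subset_union_of_subset_left
      (iUnion_mono fun i ↦ image_mono fun x hx ↦ hx.1) _)
  · -- certified slab at `τ₁` ⊆ closure (late images after `τ₁`)
    refine union_subset ?_ (iUnion_subset fun i ↦ ?_)
    · exact ((image_mono (Minkowski_timeSlab_subset_closure_lateRegion U₀ τ₁)).trans
        (image_closure_subset_closure_image hΨ₀.contMDiff.continuous)).trans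
        (closure_mono subset_union_right)
    · exact ((image_mono ((((boostedKerrBackground (mo i).1 (mo i).2 (M i)
        (a i)).truncTimeSlab_subset_timeSlab _ _)).trans
        (boostedKerr_timeSlab_subset_closure_lateRegion (mo i).1 (mo i).2 (M i) (a i) τ₁))).trans
        (image_closure_subset_closure_image (hΨ i).contMDiff.continuous)).trans
        (closure_mono ((subset_iUnion (fun i ↦ Ψ i ''
          (boostedKerrBackground (mo i).1 (mo i).2 (M i) (a i)).lateRegion τ₁) i).trans
          subset_union_left))
  · -- late images after `τ₁` ⊆ late images after `τ₀`
    exact union_subset_union (iUnion_mono fun i ↦ image_mono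
      ((boostedKerrBackground (mo i).1 (mo i).2 (M i) (a i)).lateRegion_mono hτ.le))
      (image_mono ((Minkowski.backgroundOn U₀).lateRegion_mono hτ.le))

/-- **(P9) The ray clause of `RecursO` holds for the late chart images after every `τ₁ > τ₀`.**
With the hypotheses of `exteriorOf_recurrentCharts_eq_late` and clause C9
(`RaysStayInClosure 𝒟 O`): `RaysStayInClosure 𝒟 (exteriorOf 𝒟 (late images after τ₁))`. Hence
the cofinality input of the reshaped stub (P4) may be taken to be the late recurrent chart images
after ANY chart time `τ₁`. O'Neill 1983, Ch. 14, pp. 402–404; Dafermos–Luk arXiv:1710.01722,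
Conjecture 1. -/
theorem raysStayInClosure_recurrentCharts_late
    {X : Type} [TopologicalSpace X] [ChartedSpace E3 X] [IsManifold (𝓡 3) ∞ X]
    [T2Space X] [SecondCountableTopology X] [ConnectedSpace X]
    {D : InitialDataSet (𝓡 3) X} (𝒟 : VacuumCauchyDevelopment D)
    {O : Set 𝒟.carrier} {N : ℕ} {M a : Fin N → ℝ} {mo : Fin N → lorentzGroup × E4} {τ₀ τ₁ : ℝ}
    {Ψ : ∀ i, boostedKerrExterior (mo i).1 (mo i).2 (M i) (a i) → 𝒟.carrier}
    {R : Fin N → ℝ → ℝ} {U₀ : Opens E4} {Ψ₀ : U₀ → 𝒟.carrier}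
    (hΨ : ∀ i, 𝒟.toSpacetime.IsLateChart
      (boostedKerrBackground (mo i).1 (mo i).2 (M i) (a i)) O τ₀ (Ψ i))
    (hΨ₀ : 𝒟.toSpacetime.IsLateChart (Minkowski.backgroundOn U₀) O τ₀ Ψ₀)
    (hO : O = Summit.FinalStateConjecture.exteriorOf 𝒟.toCauchyDevelopment
      ((⋃ i, Ψ i '' (boostedKerrBackground (mo i).1 (mo i).2 (M i) (a i)).lateRegion τ₀) ∪
        Ψ₀ '' (Minkowski.backgroundOn U₀).lateRegion τ₀))
    (hrays : Summit.FinalStateConjecture.RaysStayInClosure 𝒟.toCauchyDevelopment O)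
    (hτ : τ₀ < τ₁)
    (hexh : O \ (Ψ₀ '' (Minkowski.backgroundOn U₀).lateRegion τ₁ ∪
        ⋃ i, Ψ i '' {x | τ₁ < (boostedKerrBackground (mo i).1 (mo i).2 (M i) (a i)).time x.1 ∧
          (boostedKerrBackground (mo i).1 (mo i).2 (M i) (a i)).radius x.1 ≤
            R i ((boostedKerrBackground (mo i).1 (mo i).2 (M i) (a i)).time x.1)}) ⊆
      𝒟.metric.causalPast 𝒟.timeOrientation
        (Ψ₀ '' (Minkowski.backgroundOn U₀).timeSlab τ₁ ∪
          ⋃ i, Ψ i '' (boostedKerrBackground (mo i).1 (mo i).2 (M i) (a i)).truncTimeSlab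
            (R i τ₁) τ₁)) :
    Summit.FinalStateConjecture.RaysStayInClosure 𝒟.toCauchyDevelopment
      (Summit.FinalStateConjecture.exteriorOf 𝒟.toCauchyDevelopment
        ((⋃ i, Ψ i '' (boostedKerrBackground (mo i).1 (mo i).2 (M i) (a i)).lateRegion τ₁) ∪
          Ψ₀ '' (Minkowski.backgroundOn U₀).lateRegion τ₁)) := by
  rw [← exteriorOf_recurrentCharts_eq_late 𝒟 hΨ hΨ₀ hO hτ hexh]
  exact hrays

end Summit.FinalStateConjecture.FinalStateConjecture.Theorems

end
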